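import Summits.HubbardSuperconductivity.HubbardSuperconductivity.Theses.WidthHaldane
import Summits.HubbardSuperconductivity.HubbardSuperconductivity.Theorems.WidthHaldaneWidthUniformThermodynamicsLabellingInvariance
import HarnessLib

/-!
# Crux `WidthUniformThermodynamics` (stmt-HubbardSuperconductivity-16312), line `birth` —
# lead c11 RESHAPE through the canonical carrier (route `WidthHaldane`); lead c12: stub (T) LANDED

The crux: there are `U > 0`, `δ ∈ (0, 3/10)`, `d₀ > 0`, `k₀`, `M₁`, `L₀` such that on every pure
Hubbard tube `Λ_{L,M} ≃ ℤ/L × ℤ/M` (`t = 1`, `t' = 0`, ANY linearly ordered labelling `e`), `L ≥ L₀`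
even, `M₁ ≤ M ≤ L` even, at filling `N_{L,M} = 2⌊(1-δ)LM/2⌋`, `S^z = 0`:
(i) twist stiffness per site `stiff_{L,M} := 2L[E(θ=π/3) − E(0)]/((π/3)² M) ≥ d₀` and
(ii) inverse pair compressibility `0 < icomp_{L,M} := LM[E(N+2) + E(N−2) − 2E(N)]/4 ≤ k₀`
(`E` = sector minima `minEnergyOn (szSector · 0)` of the tube Hamiltonian with the seam Peierls
twist).

Reshape of the BC3 birth skeleton (same composition idea: witness point from the stiffness floor,
ceiling / strict convexity as structural consequences at that point), routed through the CANONICAL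
CARRIER `Lex (Fin L × Fin M)` with labelling `eC := ofLex ≫ (finEquiv L × finEquiv M)`:

* (T) `stub_labellingInvariance` — LANDED (p146908, `Theorems/WidthHaldaneWidthUniformThermodynamicsLabellingInvariance.lean`,
  fq `…Theorems.WidthUniformThermodynamics.stub_labellingInvariance`, from `tubeEnergy_relabel` of
  `Theorems/WidthHaldaneTubeKinematics.lean`): the tube sector energy does not depend on the labelling;
  imported and used BY NAME below (no longer a sorry of this file).
* (A) `stub_stiffnessFloorCan` — LOAD-BEARING, OPEN: width-uniform twist-stiffness floor on the
  canonical carrier (Byers–Yang / Kohn / Scalapino–White–Zhang criterion; no rigorous superfluid-weight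
  lower bound is known beyond 1D [BenfattoMastropietro2011]).
* (B) `stub_compressibilityCeilingCan` — OPEN: canonical floor ⇒ width-uniform `icomp ≤ k₀`.
* (C) `stub_staircaseConvexityCan` — OPEN: canonical floor ⇒ eventually `0 < icomp`.
* `WidthUniformThermodynamics_of : WidthUniformThermodynamics` from landed (T) and stubs (A),(B),(C) BY NAME.

A-priori facts every proof must respect (landed by route provers 2026-08-17, importable):
`tubeStiffness_le_two` (Bloch ceiling `ρ̃_{L,M} ≤ 2`, `L ≥ 3`, Theorems/WidthHaldaneTubeBlochBound), hence any
witness has `d₀ ≤ 2` (`uniformThermo_floor_le_two`); `tubeEnergy_neg` / `tubeEnergy_add_two_pi` (the envelope is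
even and 2π-periodic in θ, TubeKinematics / TubeTwoCut); `uniformThermo_iff_canonical` (carrier reduction).

Disproof used: none exists for this crux (`ledger crux ls`, 2026-08-17: no Disproof.lean / Negative).
Sources: [ScalapinoWhiteZhang1993] PRB 47, 7995; [Kohn1964]; [ByersYang1961]; [Haldane1981];
[BenfattoMastropietro2011]; [LiebRobinson1972]; [BratteliRobinsonII1997] §5.2.2 (relabelling of CAR
generators is unitarily implemented). No definition is introduced.
-/

noncomputable section

-- the summit namespace repeats the problem name by design (D-0017)
set_option linter.dupNamespace false

namespace Summit.HubbardSuperconductivity.HubbardSuperconductivity.Cruxes.WidthUniformThermodynamics.Birth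

-- same elaboration context as the route file `Theses/WidthHaldane.lean` (identical instance terms)
open scoped BigOperators Topology Manifold Classical MeasureTheory ProbabilityTheory Matrix InnerProductSpace ComplexConjugate ContinuousMap
open Filter Set Function TopologicalSpace MeasureTheory
open Literature.Hubbard
open Summit.HubbardSuperconductivity.HubbardSuperconductivity.Theses.WidthHaldane

/-! ### The three open stubs (stub (T) is landed and imported) -/

/-- **Stub (A) `stub_stiffnessFloorCan`** (LOAD-BEARING) — WIDTH-UNIFORM TWIST-STIFFNESS FLOOR OF THE
PURE HUBBARD TUBES ON THE CANONICAL CARRIER `Lex (Fin L × Fin M)` (labelling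
`eC = ofLex ≫ finEquiv × finEquiv`). There are `U > 0`, `δ ∈ (0, 3/10)`, `d₀ > 0`, `M₁`, `L₀` such
that for all even `L ≥ L₀` and all even widths `M₁ ≤ M ≤ L` the tube `hamiltonian G_{eC} 1 U` at filling
`N_{L,M} = 2⌊(1-δ)LM/2⌋`, `S^z = 0`, has `stiff_{L,M} = 2L[E(π/3) − E(0)]/((π/3)² M) ≥ d₀` (sector
minima, seam Peierls twist `e^{±iθ}` on the `M` bonds closing the long cycle). The superfluid-weight half
of the crux (Scalapino–White–Zhang / Kohn / Byers–Yang criterion on the sector-minimum envelope); by (T)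
it is equivalent to birth's all-labellings stub (A). OPEN (no rigorous superfluid-weight lower bound is
known for an itinerant repulsive fermion model beyond 1D). -/
theorem stub_stiffnessFloorCan :
    open Matrix Literature.MathematicalPhysics.QuantumLattice in
    let H0 : ∀ (L M : ℕ) (Λ : Type) [LinearOrder Λ] [Fintype Λ], (Λ ≃ ZMod L × ZMod M) → ℝ → Matrix (Finset (Orb Λ)) (Finset (Orb Λ)) ℂ := fun _ _ Λ _ _ e U => hamiltonian (SimpleGraph.fromRel fun x y : Λ => y = e.symm ((e x).1 + 1, (e x).2) ∨ y = e.symm ((e x).1, (e x).2 + 1)) 1 U;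
    let Tw : ∀ (L M : ℕ) [NeZero L] [NeZero M] (Λ : Type) [LinearOrder Λ] [Fintype Λ], (Λ ≃ ZMod L × ZMod M) → ℝ → Matrix (Finset (Orb Λ)) (Finset (Orb Λ)) ℂ := fun _ M _ _ _ _ _ e θ => ∑ b : ZMod M, ∑ σ : Fin 2, ((1 - Complex.exp (Complex.I * θ)) • (creation (orb (e.symm (0, b)) σ) * annihilation (orb (e.symm (-1, b)) σ)) + (1 - Complex.exp (-(Complex.I * θ))) • (creation (orb (e.symm (-1, b)) σ) * annihilation (orb (e.symm (0, b)) σ)));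
    let E : ∀ (L M : ℕ) [NeZero L] [NeZero M] (Λ : Type) [LinearOrder Λ] [Fintype Λ], (Λ ≃ ZMod L × ZMod M) → ℝ → ℝ → ℕ → ℝ := fun L M _ _ Λ _ _ e U θ N => (H0 L M Λ e U + Tw L M Λ e θ).minEnergyOn (szSector N 0);
    let Np : ℕ → ℕ → ℝ → ℕ := fun L M δ => 2 * ⌊(1 - δ) * ((L : ℝ) * (M : ℝ)) / 2⌋₊;
    let stiff : ∀ (L M : ℕ) [NeZero L] [NeZero M] (Λ : Type) [LinearOrder Λ] [Fintype Λ], (Λ ≃ ZMod L × ZMod M) → ℝ → ℝ → ℝ := fun L M _ _ Λ _ _ e U δ => 2 * (L : ℝ) * (E L M Λ e U (Real.pi / 3) (Np L M δ) - E L M Λ e U 0 (Np L M δ)) / ((Real.pi / 3) ^ 2 * (M : ℝ));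
    let eC : ∀ (L M : ℕ) [NeZero L] [NeZero M], Lex (Fin L × Fin M) ≃ ZMod L × ZMod M := fun L M _ _ => ofLex.trans ((ZMod.finEquiv L).toEquiv.prodCongr (ZMod.finEquiv M).toEquiv);
    ∃ U : ℝ, 0 < U ∧ ∃ δ ∈ Set.Ioo (0 : ℝ) (3 / 10), ∃ d₀ : ℝ, 0 < d₀ ∧ ∃ M₁ L₀ : ℕ, ∀ (L M : ℕ) [NeZero L] [NeZero M], Even L → Even M → M₁ ≤ M → M ≤ L → L₀ ≤ L → d₀ ≤ stiff L M (Lex (Fin L × Fin M)) (eC L M) U δ := by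
  sorry

/-- **Stub (B) `stub_compressibilityCeilingCan`** — ON THE CANONICAL CARRIER, A UNIFORMLY STIFF TUBE
FAMILY HAS WIDTH-UNIFORMLY BOUNDED INVERSE PAIR COMPRESSIBILITY. For every `U > 0`, `δ ∈ (0, 3/10)` and
data `d₀ > 0`, `M₁`, `L₀`: if `stiff_{L,M} ≥ d₀` for all even `L ≥ L₀`, even `M₁ ≤ M ≤ L` (canonical
labelling), then there are `k₀`, `M₂`, `L₁` with `icomp_{L,M} = LM[E(N+2) + E(N−2) − 2E(N)]/4 ≤ k₀` for all
even `L ≥ L₁`, even `M₂ ≤ M ≤ L` (no charge gap opens along a uniformly stiff family; heuristic engine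
`u² ≍ stiff · icomp` with the charge velocity `u` below the Lieb–Robinson velocity). OPEN. -/
theorem stub_compressibilityCeilingCan :
    open Matrix Literature.MathematicalPhysics.QuantumLattice in
    let H0 : ∀ (L M : ℕ) (Λ : Type) [LinearOrder Λ] [Fintype Λ], (Λ ≃ ZMod L × ZMod M) → ℝ → Matrix (Finset (Orb Λ)) (Finset (Orb Λ)) ℂ := fun _ _ Λ _ _ e U => hamiltonian (SimpleGraph.fromRel fun x y : Λ => y = e.symm ((e x).1 + 1, (e x).2) ∨ y = e.symm ((e x).1, (e x).2 + 1)) 1 U;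
    let Tw : ∀ (L M : ℕ) [NeZero L] [NeZero M] (Λ : Type) [LinearOrder Λ] [Fintype Λ], (Λ ≃ ZMod L × ZMod M) → ℝ → Matrix (Finset (Orb Λ)) (Finset (Orb Λ)) ℂ := fun _ M _ _ _ _ _ e θ => ∑ b : ZMod M, ∑ σ : Fin 2, ((1 - Complex.exp (Complex.I * θ)) • (creation (orb (e.symm (0, b)) σ) * annihilation (orb (e.symm (-1, b)) σ)) + (1 - Complex.exp (-(Complex.I * θ))) • (creation (orb (e.symm (-1, b)) σ) * annihilation (orb (e.symm (0, b)) σ)));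
    let E : ∀ (L M : ℕ) [NeZero L] [NeZero M] (Λ : Type) [LinearOrder Λ] [Fintype Λ], (Λ ≃ ZMod L × ZMod M) → ℝ → ℝ → ℕ → ℝ := fun L M _ _ Λ _ _ e U θ N => (H0 L M Λ e U + Tw L M Λ e θ).minEnergyOn (szSector N 0);
    let Np : ℕ → ℕ → ℝ → ℕ := fun L M δ => 2 * ⌊(1 - δ) * ((L : ℝ) * (M : ℝ)) / 2⌋₊;
    let stiff : ∀ (L M : ℕ) [NeZero L] [NeZero M] (Λ : Type) [LinearOrder Λ] [Fintype Λ], (Λ ≃ ZMod L × ZMod M) → ℝ → ℝ → ℝ := fun L M _ _ Λ _ _ e U δ => 2 * (L : ℝ) * (E L M Λ e U (Real.pi / 3) (Np L M δ) - E L M Λ e U 0 (Np L M δ)) / ((Real.pi / 3) ^ 2 * (M : ℝ));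
    let icomp : ∀ (L M : ℕ) [NeZero L] [NeZero M] (Λ : Type) [LinearOrder Λ] [Fintype Λ], (Λ ≃ ZMod L × ZMod M) → ℝ → ℝ → ℝ := fun L M _ _ Λ _ _ e U δ => (L : ℝ) * (M : ℝ) * (E L M Λ e U 0 (Np L M δ + 2) + E L M Λ e U 0 (Np L M δ - 2) - 2 * E L M Λ e U 0 (Np L M δ)) / 4;
    let eC : ∀ (L M : ℕ) [NeZero L] [NeZero M], Lex (Fin L × Fin M) ≃ ZMod L × ZMod M := fun L M _ _ => ofLex.trans ((ZMod.finEquiv L).toEquiv.prodCongr (ZMod.finEquiv M).toEquiv);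
    ∀ U : ℝ, 0 < U → ∀ δ ∈ Set.Ioo (0 : ℝ) (3 / 10), ∀ (d₀ : ℝ) (M₁ L₀ : ℕ), 0 < d₀ → (∀ (L M : ℕ) [NeZero L] [NeZero M], Even L → Even M → M₁ ≤ M → M ≤ L → L₀ ≤ L → d₀ ≤ stiff L M (Lex (Fin L × Fin M)) (eC L M) U δ) → ∃ k₀ : ℝ, ∃ M₂ L₁ : ℕ, ∀ (L M : ℕ) [NeZero L] [NeZero M], Even L → Even M → M₂ ≤ M → M ≤ L → L₁ ≤ L → icomp L M (Lex (Fin L × Fin M)) (eC L M) U δ ≤ k₀ := by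
  sorry

/-- **Stub (C) `stub_staircaseConvexityCan`** — ON THE CANONICAL CARRIER, A UNIFORMLY STIFF TUBE FAMILY
HAS A STRICTLY CONVEX EVEN-`N` STAIRCASE AT THE TARGET FILLING. For every `U > 0`, `δ ∈ (0, 3/10)` and
data `d₀ > 0`, `M₁`, `L₀`: if `stiff_{L,M} ≥ d₀` for all even `L ≥ L₀`, even `M₁ ≤ M ≤ L` (canonical
labelling), then there are `M₂`, `L₁` with `0 < icomp_{L,M}`, i.e. `E(N+2) + E(N−2) > 2E(N)` at
`N = N_{L,M}`, for all even `L ≥ L₁`, even `M₂ ≤ M ≤ L` (no phase separation / negative pair-binding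
curvature in a uniformly stiff family). OPEN. -/
theorem stub_staircaseConvexityCan :
    open Matrix Literature.MathematicalPhysics.QuantumLattice in
    let H0 : ∀ (L M : ℕ) (Λ : Type) [LinearOrder Λ] [Fintype Λ], (Λ ≃ ZMod L × ZMod M) → ℝ → Matrix (Finset (Orb Λ)) (Finset (Orb Λ)) ℂ := fun _ _ Λ _ _ e U => hamiltonian (SimpleGraph.fromRel fun x y : Λ => y = e.symm ((e x).1 + 1, (e x).2) ∨ y = e.symm ((e x).1, (e x).2 + 1)) 1 U;
    let Tw : ∀ (L M : ℕ) [NeZero L] [NeZero M] (Λ : Type) [LinearOrder Λ] [Fintype Λ], (Λ ≃ ZMod L × ZMod M) → ℝ → Matrix (Finset (Orb Λ)) (Finset (Orb Λ)) ℂ := fun _ M _ _ _ _ _ e θ => ∑ b : ZMod M, ∑ σ : Fin 2, ((1 - Complex.exp (Complex.I * θ)) • (creation (orb (e.symm (0, b)) σ) * annihilation (orb (e.symm (-1, b)) σ)) + (1 - Complex.exp (-(Complex.I * θ))) • (creation (orb (e.symm (-1, b)) σ) * annihilation (orb (e.symm (0, b)) σ)));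
    let E : ∀ (L M : ℕ) [NeZero L] [NeZero M] (Λ : Type) [LinearOrder Λ] [Fintype Λ], (Λ ≃ ZMod L × ZMod M) → ℝ → ℝ → ℕ → ℝ := fun L M _ _ Λ _ _ e U θ N => (H0 L M Λ e U + Tw L M Λ e θ).minEnergyOn (szSector N 0);
    let Np : ℕ → ℕ → ℝ → ℕ := fun L M δ => 2 * ⌊(1 - δ) * ((L : ℝ) * (M : ℝ)) / 2⌋₊;
    let stiff : ∀ (L M : ℕ) [NeZero L] [NeZero M] (Λ : Type) [LinearOrder Λ] [Fintype Λ], (Λ ≃ ZMod L × ZMod M) → ℝ → ℝ → ℝ := fun L M _ _ Λ _ _ e U δ => 2 * (L : ℝ) * (E L M Λ e U (Real.pi / 3) (Np L M δ) - E L M Λ e U 0 (Np L M δ)) / ((Real.pi / 3) ^ 2 * (M : ℝ));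
    let icomp : ∀ (L M : ℕ) [NeZero L] [NeZero M] (Λ : Type) [LinearOrder Λ] [Fintype Λ], (Λ ≃ ZMod L × ZMod M) → ℝ → ℝ → ℝ := fun L M _ _ Λ _ _ e U δ => (L : ℝ) * (M : ℝ) * (E L M Λ e U 0 (Np L M δ + 2) + E L M Λ e U 0 (Np L M δ - 2) - 2 * E L M Λ e U 0 (Np L M δ)) / 4;
    let eC : ∀ (L M : ℕ) [NeZero L] [NeZero M], Lex (Fin L × Fin M) ≃ ZMod L × ZMod M := fun L M _ _ => ofLex.trans ((ZMod.finEquiv L).toEquiv.prodCongr (ZMod.finEquiv M).toEquiv);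
    ∀ U : ℝ, 0 < U → ∀ δ ∈ Set.Ioo (0 : ℝ) (3 / 10), ∀ (d₀ : ℝ) (M₁ L₀ : ℕ), 0 < d₀ → (∀ (L M : ℕ) [NeZero L] [NeZero M], Even L → Even M → M₁ ≤ M → M ≤ L → L₀ ≤ L → d₀ ≤ stiff L M (Lex (Fin L × Fin M)) (eC L M) U δ) → ∃ M₂ L₁ : ℕ, ∀ (L M : ℕ) [NeZero L] [NeZero M], Even L → Even M → M₂ ≤ M → M ≤ L → L₁ ≤ L → 0 < icomp L M (Lex (Fin L × Fin M)) (eC L M) U δ := by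
  sorry

/-! ### Composition: the crux from the four stubs (real proofs, no `sorry` below this line) -/

/-- **`WidthUniformThermodynamics_of`** — THE SKELETON: the line closes the crux modulo its stubs.
`WidthUniformThermodynamics` (route `WidthHaldane`, item stmt-HubbardSuperconductivity-16312) from
the four registered stubs BY NAME — the witness point `(U, δ, d₀)` comes from `stub_stiffnessFloorCan`
(A); `stub_compressibilityCeilingCan` (B) and `stub_staircaseConvexityCan` (C) are applied at that
point to the canonical floor of (A); thresholds merged by `max`; finally the three canonical-carrier
bounds are moved to an arbitrary labelled carrier `(Λ, e)` by `stub_labellingInvariance` (T). -/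
theorem WidthUniformThermodynamics_of : WidthUniformThermodynamics := by
  have hT := Summit.HubbardSuperconductivity.HubbardSuperconductivity.Theorems.WidthUniformThermodynamics.stub_labellingInvariance
  obtain ⟨U, hU, δ, hδ, d₀, hd₀, M₁, L₀, hst⟩ := stub_stiffnessFloorCan
  obtain ⟨k₀, M₂, L₁, hk⟩ := stub_compressibilityCeilingCan U hU δ hδ d₀ M₁ L₀ hd₀ hst
  obtain ⟨M₃, L₂, hpos⟩ := stub_staircaseConvexityCan U hU δ hδ d₀ M₁ L₀ hd₀ hst
  dsimp only [WidthUniformThermodynamics]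
  refine ⟨U, hU, δ, hδ, d₀, hd₀, k₀, max M₁ (max M₂ M₃), max L₀ (max L₁ L₂), ?_⟩
  intro L M _ _ hLe hMe hM hML hL Λ _ _ e
  rw [max_le_iff, max_le_iff] at hM hL
  have h1 := hst L M hLe hMe hM.1 hML hL.1
  have h2 := hpos L M hLe hMe hM.2.2 hML hL.2.2
  have h3 := hk L M hLe hMe hM.2.1 hML hL.2.1
  have key := fun θ N => hT L M Λ (Lex (Fin L × Fin M)) e
    (ofLex.trans ((ZMod.finEquiv L).toEquiv.prodCongr (ZMod.finEquiv M).toEquiv)) U θ N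
  dsimp only at h1 h2 h3 key ⊢
  simp only [key]
  exact ⟨h1, h2, h3⟩

end Summit.HubbardSuperconductivity.HubbardSuperconductivity.Cruxes.WidthUniformThermodynamics.Birth

end
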